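import Summits.BirchSwinnertonDyer.BirchSwinnertonDyer.Theses.ResidualThetaTransportAtTwo
import Summits.BirchSwinnertonDyer.BirchSwinnertonDyer.Theorems.ResidualThetaTransportAtTwoRlfOfTwistedEventualLevelDescent
import Summits.BirchSwinnertonDyer.BirchSwinnertonDyer.Theorems.ResidualThetaTransportAtTwoRlfTwistedAmbientGeneric
import Summits.BirchSwinnertonDyer.BirchSwinnertonDyer.Theorems.ResidualThetaTransportAtTwoRlfTwistedLiftPlusTwoOfEventual
import Summits.BirchSwinnertonDyer.BirchSwinnertonDyer.Theorems.ResidualThetaTransportAtTwoRlfTwistedEventualPlusLiftAlt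
import Summits.BirchSwinnertonDyer.BirchSwinnertonDyer.Theorems.ResidualThetaTransportAtTwoRlfSharpEigenFinite
import Summits.BirchSwinnertonDyer.BirchSwinnertonDyer.Theorems.ResidualThetaTransportAtTwoRlfTwistedPlusDualOfIso
import HarnessLib

/-!
# Item 23110 `ResidualLambdaFormulaNegDiscAtTwo` BY NAME from PRINT {weak Leopoldt at `2`, Prop. 4.12} + ONE named input: the ISOTROPY at `2`
# of the twisted signed local Kummer conditions, `hiso(u)` = Kim 2007 Prop. 3.15 read at `2` (twisted, level `ℚ_2`), for `u` outside a finite set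

Route `ResidualThetaTransportAtTwo` (RTT, crux r201, stmt-BirchSwinnertonDyer-23110) / `ThetaPartnerAtTwo` (TP2, aside r205). Seat
`prover-bsd-wall-tp2-p2x` g12 LEAD: the closer-modulo-`hdual_Alt` door `…RlfOfPlusDualAltOnlyDoor` (p667890) composed with w2 g15's counting
reduction `TwistedLocalKummer.plusDualAlt_of_iso` (p668303: `hiso → hdual_Alt`, by `#L_u = 2^J`, `#H¹ = 4^J`, perfectness). `--supports
stmt-BirchSwinnertonDyer-23110`. THEOREMS ONLY; LEAF file (imports the route file and route-independent helpers only).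

* **`residualLambdaFormulaNegDiscAtTwo_of_print_of_iso (hWL) (h412) (hI)`** : the RTT route decl BY NAME, where `hI` = «for every cyclotomic
  datum, admissible `S₀`, curve `E` of the branch with `X⁺` torsion and `μ = 0`: a finite `B ⊆ ℤ` with `hiso(u)` for all odd `u ∉ B`»
  (binder VERBATIM the `hiso` of `plusDualAlt_of_iso`): `⟨x, H¹(w) y'⟩_v = 0` for `x ∈ L_u`, `y' ∈ L_{u'}`, `u u' ≡ 1 (2^J)`;
* `residualLambdaFormulaNegDiscAtTwo_TP2_of_print_of_iso` — the TP2 twin.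

So the ledger shows: 23110 ⟸ PRINT (hWL, h412) + ISO. CONDITIONAL; closes nothing by itself; BSD is not proved by any of this.
[cite: GreenbergLNM1716, §4 Props. 4.12–4.14 (pp. 119–124)] [cite: BDKim2007, Props. 3.15, 3.18]
-/

set_option autoImplicit false
set_option linter.dupNamespace false

noncomputable section

open scoped Classical NumberField AddSubgroup

open NumberField IsDedekindDomain Field

namespace Summit.BirchSwinnertonDyer.BirchSwinnertonDyer.Theorems.SignedEC.TwistedLocalDescent

open Literature.NumberTheory.EllipticCurves Literature.NumberTheory.GaloisRepresentations
  Literature.NumberTheory.GaloisCohomology WeierstrassCurve ZpExtension Literature.NumberTheory.EllipticCurves.Kobayashi2003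
  Literature.NumberTheory.EllipticCurves.GreenbergVatsal2000 Literature.NumberTheory.EllipticCurves.GreenbergSelmer
  Literature.NumberTheory.EllipticCurves.Rank1Residual
open Literature.NumberTheory.GaloisRepresentations.DiscreteGaloisModule (localTatePairingZMod)

/-- **Item 23110 BY NAME from print + ISO(u) for generic odd `u`.** Granted weak Leopoldt (`Greenberg1999.h1SigmaInfty_rank_eq_one`) and
Prop. 4.12 (`Greenberg1999.prop412_noFiniteSubmodule_H1Sigma_of_rank_one`) BY NAME, and — for every cyclotomic datum, admissible `S₀`, curve `E`
of the branch, dual datum with `X⁺` torsion and `μ = 0` — the isotropy `hiso(u)` of the twisted signed local Kummer conditions at `2` for all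
odd `u` outside a finite set (binder VERBATIM the `hiso` of `TwistedLocalKummer.plusDualAlt_of_iso`), the route decl holds with `c = 0`:
`plusDualAlt_of_iso` gives `hdual_Alt(u)`, H-FIN is the theorem `SharpEigen.finite_setOf_not_exists_uniformExponent_sharp_two`, LIFT⁺₂ and
(TCAS-K)_ev are w3's / the lead's theorems. CONDITIONAL; closes nothing.
[cite: GreenbergLNM1716, §4 Props. 4.12–4.14 (pp. 119–124)] [cite: BDKim2007, Props. 3.15, 3.18] -/
theorem residualLambdaFormulaNegDiscAtTwo_of_print_of_iso
    (hWL : Greenberg1999.h1SigmaInfty_rank_eq_one)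
    (h412 : Greenberg1999.prop412_noFiniteSubmodule_H1Sigma_of_rank_one)
    (hDF : ∀ (κ : ZpExtension ℚ 2) (γ : Field.absoluteGaloisGroup ℚ), κ.IsCyclotomic → κ.IsTopGenerator γ →
      ∀ (S₀ : Finset (HeightOneSpectrum (𝓞 ℚ))), (∀ v ∈ S₀, ((2 : ℕ) : 𝓞 ℚ) ∉ v.asIdeal) →
      ∀ (E : WeierstrassCurve ℚ) [E.IsElliptic] [E.IsGloballyMinimal], GoodSS E 2 → E.frobeniusTrace 2 = 0 → E.Δ < 0 →
        (∀ v : HeightOneSpectrum (𝓞 ℚ), ¬ E.HasGoodReductionAt v → v ∈ S₀) →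
      ∀ (D : SignedSelmerDualData E κ γ 1) [Module.Finite (IwasawaAlgebra 2) D.X],
        Module.IsTorsion (IwasawaAlgebra 2) D.X → D.mu = 0 →
      ∃ B : Set ℤ, B.Finite ∧ ∀ u : ℤ, u ∉ B → ∀ hu : (2 : ℤ) ∣ u - 1,
        (∀ (J : ℕ) (u' : ℤ) (hu' : (2 : ℤ) ∣ u' - 1) (huu' : ((2 : ℤ) ^ J) ∣ u * u' - 1)
      (e : E.geomTorsion ((2 ^ J : ℕ) : ℤ) → E.geomTorsion ((2 ^ J : ℕ) : ℤ) → AlgebraicClosure ℚ)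
      (hμ : ∀ S T, e S T ^ (2 ^ J) = 1) (hadd₁ : ∀ S₁ S₂ T, e (S₁ + S₂) T = e S₁ T * e S₂ T)
      (hadd₂ : ∀ S T₁ T₂, e S (T₁ + T₂) = e S T₁ * e S T₂)
      (hgal : ∀ (σ : absoluteGaloisGroup ℚ) (S T : E.geomTorsion ((2 ^ J : ℕ) : ℤ)), σ • e S T = e (σ • S) (σ • T))
      (halt : ∀ T, e T T = 1) (hnondeg : ∀ T, (∀ S, e S T = 1) → T = 0)
      [Finite (E.geomTorsion ((2 ^ J : ℕ) : ℤ))]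
      (inv : LocalInvariants ℚ (2 ^ J)), inv.IsPerfect →
      ∀ (v : HeightOneSpectrum (𝓞 ℚ)), ((2 : ℕ) : 𝓞 ℚ) ∈ v.asIdeal →
      ∀ x ∈ E.twistedTorsionLocalKummer 2 κ J u hu (v.adicCompletion ℚ) (⨆ n : ℕ, signedLocalPoints κ (v.adicCompletion ℚ) E 1 n),
      ∀ y' ∈ E.twistedTorsionLocalKummer 2 κ J u' hu' (v.adicCompletion ℚ) (⨆ n : ℕ, signedLocalPoints κ (v.adicCompletion ℚ) E 1 n),
        localTatePairingZMod (E.twistedTorsionGaloisModule 2 κ J u hu) (2 ^ J) (Sum.inr v) (inv (Sum.inr v)) x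
          (galoisCohomology.map ((E.twistedWeilDual 2 κ J hu hu' huu' e hμ hadd₁ hadd₂ hgal).restrictField (v.adicCompletion ℚ)) 1
            y') = 0)) :
    Summit.BirchSwinnertonDyer.BirchSwinnertonDyer.Theses.ResidualThetaTransportAtTwo.ResidualLambdaFormulaNegDiscAtTwo := by
  intro κ γ hκ hγ S₀ hS2
  refine ⟨0, fun E _ _ hss ha hΔ hS D _ hX hμ ↦ ?_⟩
  obtain ⟨B, hB, hDFu⟩ := hDF κ γ hκ hγ S₀ hS2 E hss ha hΔ hS D hX hμ
  have hgood : ∀ v : HeightOneSpectrum (𝓞 ℚ), v ∉ S₀ → ((2 : ℕ) : 𝓞 ℚ) ∉ v.asIdeal → E.HasGoodReductionAt v :=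
    fun v hv _ ↦ by by_contra hng; exact hv (hS v hng)
  -- H-FIN is a theorem: enlarge `B` by the finite exceptional set of `SharpEigen.finite_setOf_not_exists_uniformExponent_sharp_two`
  have hBfin := SharpEigen.finite_setOf_not_exists_uniformExponent_sharp_two E hΔ κ hκ hγ S₀ hS2 D hX
  obtain ⟨u, huB, hu, hH⟩ := TwistedSurj.exists_twistedCoinv_H1Sigma_of_print hWL h412 E 2 κ γ hκ hγ S₀ hgood _ (hB.union hBfin)
  rw [Set.mem_union, not_or] at huB
  have hu' : (2 : ℤ) ∣ u - 1 := by exact_mod_cast hu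
  have hdual := TwistedLocalKummer.plusDualAlt_of_iso E hss ha hκ u hu' (hDFu u huB.1 hu')
  have hfinE' := huB.2
  simp only [Set.mem_setOf_eq, not_and, not_not] at hfinE'
  have hfinE := hfinE' hu'
  simpa only [Nat.add_zero] using
    rlf2_of_twistedEventualLevelDescent κ γ hκ hγ S₀ hS2 E hss ha hΔ hS D hX hμ (u := u) (by exact_mod_cast hu') hH
      (TwistedPT.liftPlusTwo_of_liftPlusEventual E hss ha S₀ κ hκ hγ u hu'
        (fun J x₂ ↦ TwistedPT.liftPlusEventual_two_of_plusDualAlt_of_eigen E hss S₀ κ hγ u hu' 1 hS2 hS hdual hfinE J x₂))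
      (fun J t ↦ TwistedPT.hlevEventual_two_of_plusDualAlt_of_eigen E hss S₀ κ hγ u hu' 1 hS2 hS hdual hfinE J t)

/-- **The same for the TP2 decl** `Theses.ThetaPartnerAtTwo.ResidualLambdaFormulaNegDiscAtTwo` (identical text).
[cite: GreenbergLNM1716, §4 Props. 4.12–4.14 (pp. 119–124)] [cite: GreenbergVatsal2000, §2 Prop. (2.1) and (10)] -/
theorem residualLambdaFormulaNegDiscAtTwo_TP2_of_print_of_iso
    (hWL : Greenberg1999.h1SigmaInfty_rank_eq_one)
    (h412 : Greenberg1999.prop412_noFiniteSubmodule_H1Sigma_of_rank_one)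
    (hDF : ∀ (κ : ZpExtension ℚ 2) (γ : Field.absoluteGaloisGroup ℚ), κ.IsCyclotomic → κ.IsTopGenerator γ →
      ∀ (S₀ : Finset (HeightOneSpectrum (𝓞 ℚ))), (∀ v ∈ S₀, ((2 : ℕ) : 𝓞 ℚ) ∉ v.asIdeal) →
      ∀ (E : WeierstrassCurve ℚ) [E.IsElliptic] [E.IsGloballyMinimal], GoodSS E 2 → E.frobeniusTrace 2 = 0 → E.Δ < 0 →
        (∀ v : HeightOneSpectrum (𝓞 ℚ), ¬ E.HasGoodReductionAt v → v ∈ S₀) →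
      ∀ (D : SignedSelmerDualData E κ γ 1) [Module.Finite (IwasawaAlgebra 2) D.X],
        Module.IsTorsion (IwasawaAlgebra 2) D.X → D.mu = 0 →
      ∃ B : Set ℤ, B.Finite ∧ ∀ u : ℤ, u ∉ B → ∀ hu : (2 : ℤ) ∣ u - 1,
        (∀ (J : ℕ) (u' : ℤ) (hu' : (2 : ℤ) ∣ u' - 1) (huu' : ((2 : ℤ) ^ J) ∣ u * u' - 1)
      (e : E.geomTorsion ((2 ^ J : ℕ) : ℤ) → E.geomTorsion ((2 ^ J : ℕ) : ℤ) → AlgebraicClosure ℚ)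
      (hμ : ∀ S T, e S T ^ (2 ^ J) = 1) (hadd₁ : ∀ S₁ S₂ T, e (S₁ + S₂) T = e S₁ T * e S₂ T)
      (hadd₂ : ∀ S T₁ T₂, e S (T₁ + T₂) = e S T₁ * e S T₂)
      (hgal : ∀ (σ : absoluteGaloisGroup ℚ) (S T : E.geomTorsion ((2 ^ J : ℕ) : ℤ)), σ • e S T = e (σ • S) (σ • T))
      (halt : ∀ T, e T T = 1) (hnondeg : ∀ T, (∀ S, e S T = 1) → T = 0)
      [Finite (E.geomTorsion ((2 ^ J : ℕ) : ℤ))]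
      (inv : LocalInvariants ℚ (2 ^ J)), inv.IsPerfect →
      ∀ (v : HeightOneSpectrum (𝓞 ℚ)), ((2 : ℕ) : 𝓞 ℚ) ∈ v.asIdeal →
      ∀ x ∈ E.twistedTorsionLocalKummer 2 κ J u hu (v.adicCompletion ℚ) (⨆ n : ℕ, signedLocalPoints κ (v.adicCompletion ℚ) E 1 n),
      ∀ y' ∈ E.twistedTorsionLocalKummer 2 κ J u' hu' (v.adicCompletion ℚ) (⨆ n : ℕ, signedLocalPoints κ (v.adicCompletion ℚ) E 1 n),
        localTatePairingZMod (E.twistedTorsionGaloisModule 2 κ J u hu) (2 ^ J) (Sum.inr v) (inv (Sum.inr v)) x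
          (galoisCohomology.map ((E.twistedWeilDual 2 κ J hu hu' huu' e hμ hadd₁ hadd₂ hgal).restrictField (v.adicCompletion ℚ)) 1
            y') = 0)) :
    Summit.BirchSwinnertonDyer.BirchSwinnertonDyer.Theses.ThetaPartnerAtTwo.ResidualLambdaFormulaNegDiscAtTwo :=
  residualLambdaFormulaNegDiscAtTwo_of_print_of_iso hWL h412 hDF

end Summit.BirchSwinnertonDyer.BirchSwinnertonDyer.Theorems.SignedEC.TwistedLocalDescent

end
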